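import Literature.Computability.QuantumComplexity.PhaseKickProgram
import Literature.Computability.QuantumComplexity.ObliviousAmplification
import HarnessLib

/-!
# The reflection about the all-zero subspace of a list of wires as a Clifford+T circuit

Topic `Literature/Computability/QuantumComplexity`; a step in the discharge of
`ajl_jonesApproxProblem_mem_PromiseBQP` (the reflections `1 − 2Π` of oblivious amplitude
amplification, `ObliviousAmplification.lean`). For wires `a₀ :: ls` (the ancillas whose all-zero
subspace `P₀` is reflected about) and as many fresh helper wires `as` as literals `ls`, the program

  `reflectProg a₀ ls as = X on a₀ :: ls ;  Toffoli chain computing (¬a₀ ∧ ¬l₁ ∧ ⋯) into as`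

fed to `phaseKickCircuit` with a `Z` on the last helper gives a circuit whose matrix is the diagonal
`phaseDiag` of `PhaseKickProgram.lean` (`reflectCircuit_toMatrix`), equal to `(−1)^{[y ∈ P₀]}` at every
label `y` clean on the helpers (`reflectExp_eq`), i.e. the circuit acts as `1 − 2·projOn P₀` on every
state supported on helper-clean labels (`reflectCircuit_mulVec_eq`). Nielsen–Chuang 2010, §4.3
(multiply controlled gates with work qubits, Fig. 4.10) and §6.1.2 (the conditional phase shift
`2|0⟩⟨0| − I` of amplitude amplification).

## References

* M. A. Nielsen, I. L. Chuang, *Quantum Computation and Quantum Information*, CUP 2010, §4.3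
  Fig. 4.10, §6.1.2 [NielsenChuang2010].
-/

noncomputable section

namespace Literature.Computability.QuantumComplexity

open _root_.Matrix Cryptography

variable {N : ℕ}

/-- The classical program of the reflection: negate the reflected wires, then the conjunction chain
into the helpers. [cite: NielsenChuang2010, §4.3 Fig. 4.10] -/
def reflectProg (a₀ : Fin N) (ls as : List (Fin N)) : List (ClOp (Fin N)) :=
  (a₀ :: ls).map ClOp.not ++ clChain a₀ ls as

/-- The reflection program is well formed when the helpers are distinct and disjoint from the reflected
wires. [folklore] -/
theorem reflectProg_wf {a₀ : Fin N} {ls as : List (Fin N)} (hnd : as.Nodup) (h0 : a₀ ∉ as)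
    (hls : ∀ l ∈ ls, l ∉ as ∧ l ≠ a₀) : ∀ op ∈ reflectProg a₀ ls as, op.WF := by
  intro op hop
  rw [reflectProg, List.mem_append, List.mem_map] at hop
  rcases hop with ⟨i, _, rfl⟩ | hop
  · trivial
  · exact wf_of_mem_clChain hnd h0 hls hop

/-- **The flag computed by the reflection program**: on labels clean on the helpers, the last helper
ends up holding `[all reflected wires are 0]`. [cite: NielsenChuang2010, §4.3 Fig. 4.10] -/
theorem clEval_reflectProg_getLast {a₀ : Fin N} {ls as : List (Fin N)} (hlen : ls.length = as.length) (hne : as ≠ [])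
    (hnd : as.Nodup) (h0 : a₀ ∉ as) (hls : ∀ l ∈ ls, l ∉ as ∧ l ≠ a₀) (hlsnd : (a₀ :: ls).Nodup)
    (y : QReg N) (hy : ∀ a ∈ as, y a = false) :
    clEval (reflectProg a₀ ls as) y (as.getLast hne) = decide (∀ i ∈ a₀ :: ls, y i = false) := by
  rw [reflectProg, clEval_append]
  set y' := clEval ((a₀ :: ls).map ClOp.not) y with hy'
  have hflip : ∀ i ∈ a₀ :: ls, y' i = !y i := fun i hi => clEval_map_not_of_mem _ hlsnd y hi
  have hkeep : ∀ i ∉ a₀ :: ls, y' i = y i := fun i hi => clEval_map_not_of_not_mem _ y hi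
  have hy'as : ∀ a ∈ as, y' a = false := by
    intro a ha
    rw [hkeep a (by
      simp only [List.mem_cons, not_or]
      exact ⟨fun e => h0 (e ▸ ha), fun h => (hls a h).1 ha⟩)]
    exact hy a ha
  rw [clEval_clChain_getLast a₀ ls as y' hlen hne hnd (fun l hl => (hls l hl).1) hy'as, hflip a₀ (by simp)]
  have hall : ls.all y' = decide (∀ l ∈ ls, y l = false) := by
    apply Bool.eq_iff_iff.2
    rw [List.all_eq_true, decide_eq_true_iff]
    refine forall₂_congr fun l hl => ?_
    rw [hflip l (List.mem_cons_of_mem _ hl)]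
    cases y l <;> simp
  rw [hall]
  cases h : y a₀ <;> simp [h]

variable (a₀ : Fin N) (ls as : List (Fin N))

/-- **The reflection circuit**: compute the flag, `Z` on it, uncompute. [cite: NielsenChuang2010, §6.1.2] -/
def reflectCircuit (hne : as ≠ []) (hwf : ∀ op ∈ reflectProg a₀ ls as, op.WF) : QCircuit cliffordT N :=
  phaseKickCircuit (reflectProg a₀ ls as) hwf [] [as.getLast hne]

/-- The reflection circuit is a diagonal `±1` phase matrix. [folklore] -/
theorem reflectCircuit_toMatrix (A : Language Bool) (hne : as ≠ []) (hwf : ∀ op ∈ reflectProg a₀ ls as, op.WF) :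
    (reflectCircuit a₀ ls as hne hwf).toMatrix A = phaseDiag (phaseKickExp (reflectProg a₀ ls as) [] [as.getLast hne]) :=
  phaseKickCircuit_toMatrix A _ hwf _ _

/-- The reflection circuit is oracle-free. [folklore] -/
theorem reflectCircuit_isOracleFree (hne : as ≠ []) (hwf : ∀ op ∈ reflectProg a₀ ls as, op.WF) :
    (reflectCircuit a₀ ls as hne hwf).IsOracleFree :=
  phaseKickCircuit_isOracleFree _ hwf _ _

variable {a₀ ls as}

/-- **The kicked exponent on helper-clean labels** is `2·[y ∈ P₀]`. [cite: NielsenChuang2010, §6.1.2] -/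
theorem reflectExp_eq (hlen : ls.length = as.length) (hne : as ≠ []) (hnd : as.Nodup) (h0 : a₀ ∉ as)
    (hls : ∀ l ∈ ls, l ∉ as ∧ l ≠ a₀) (hlsnd : (a₀ :: ls).Nodup) (y : QReg N) (hy : ∀ a ∈ as, y a = false) :
    phaseKickExp (reflectProg a₀ ls as) [] [as.getLast hne] y = 2 * (decide (∀ i ∈ a₀ :: ls, y i = false)).toNat := by
  rw [phaseKickExp, countOn, countOn, List.countP_nil, zero_add, List.countP_cons, List.countP_nil, zero_add,
    clEval_reflectProg_getLast hlen hne hnd h0 hls hlsnd y hy]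
  cases decide (∀ i ∈ a₀ :: ls, y i = false) <;> simp

/-- **The reflection circuit acts as `1 − 2·projOn P₀`** (`P₀` = all reflected wires zero) on every
state supported on labels clean on the helpers. [cite: NielsenChuang2010, §6.1.2] -/
theorem reflectCircuit_mulVec_eq (A : Language Bool) (hlen : ls.length = as.length) (hne : as ≠ []) (hnd : as.Nodup)
    (h0 : a₀ ∉ as) (hls : ∀ l ∈ ls, l ∉ as ∧ l ≠ a₀) (hlsnd : (a₀ :: ls).Nodup)
    (hwf : ∀ op ∈ reflectProg a₀ ls as, op.WF) (ψ : QReg N → ℂ) (hψ : SuppIn {y | ∀ a ∈ as, y a = false} ψ) :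
    (reflectCircuit a₀ ls as hne hwf).toMatrix A *ᵥ ψ =
      (1 - (2 : ℂ) • projOn {y : QReg N | ∀ i ∈ a₀ :: ls, y i = false}) *ᵥ ψ := by
  classical
  ext y
  rw [reflectCircuit_toMatrix, phaseDiag, Matrix.mulVec_diagonal, Matrix.sub_mulVec, Matrix.one_mulVec, Pi.sub_apply,
    Matrix.smul_mulVec, Pi.smul_apply, projOn_mulVec_apply, smul_eq_mul]
  by_cases hy : ∀ a ∈ as, y a = false
  · rw [reflectExp_eq hlen hne hnd h0 hls hlsnd y hy]
    by_cases hP : ∀ i ∈ a₀ :: ls, y i = false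
    · rw [decide_eq_true hP, Bool.toNat_true, mul_one, Complex.I_sq,
        Set.indicator_of_mem (show y ∈ {y : QReg N | ∀ i ∈ a₀ :: ls, y i = false} from hP)]
      ring
    · rw [decide_eq_false hP, Bool.toNat_false, mul_zero, pow_zero, one_mul,
        Set.indicator_of_notMem (show y ∉ {y : QReg N | ∀ i ∈ a₀ :: ls, y i = false} from hP), mul_zero, sub_zero]
  · have h0ψ : ψ y = 0 := hψ y hy
    simp [h0ψ, Set.indicator_apply]

end Literature.Computability.QuantumComplexity

end
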